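import Summits.CriticalPhenomena.PercolationContinuityZ3.Theorems.Transplant.PlanarSkeletonFrmQuasiDefs
import Summits.CriticalPhenomena.PercolationContinuityZ3.Theorems.Transplant.SkelFrmQuasiBChoiceNums
import Summits.CriticalPhenomena.PercolationContinuityZ3.Theorems.Transplant.SkelFrmBChoiceNums
import Summits.CriticalPhenomena.PercolationContinuityZ3.Theorems.Transplant.SkelFrmQuasiBParamsFaceBandA
import Summits.CriticalPhenomena.PercolationContinuityZ3.Theorems.Transplant.SkelFrmBParamsFaceBandA
import Summits.CriticalPhenomena.PercolationContinuityZ3.Theorems.Transplant.SkelFrmQuasiBParamsSlotsTA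
import Summits.CriticalPhenomena.PercolationContinuityZ3.Theorems.Transplant.SkelFrmBParamsSlotsTA
import Summits.CriticalPhenomena.PercolationContinuityZ3.Theorems.Transplant.SkelFrmQuasi1ChoiceDefs
import Summits.CriticalPhenomena.PercolationContinuityZ3.Theorems.Transplant.SkelFrmQuasi1ParamsLBL
import Summits.CriticalPhenomena.PercolationContinuityZ3.Theorems.Transplant.SkelFrmQuasi1ParamsPO
import Summits.CriticalPhenomena.PercolationContinuityZ3.Theorems.Transplant.SkelFrmQuasiBParamsFaceUnits
import Summits.CriticalPhenomena.PercolationContinuityZ3.Theorems.Transplant.SkelFrmQuasiBParamsLF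
import Summits.CriticalPhenomena.PercolationContinuityZ3.Theorems.Transplant.SkelFrmQuasiBParamsLFA
import Summits.CriticalPhenomena.PercolationContinuityZ3.Theorems.Transplant.SkelFrmQuasi1SlotTypes
import HarnessLib
import Summits.CriticalPhenomena.PercolationContinuityZ3.Theorems.Transplant.SkelFrmBParamsFaceBandAR0
/-!
# GEN-Q PORT (WAVE-Q table v0.8 section 2, row G132, U-level L16; captain R-6/R-7 2026-08-27: carrier token swap `PlanarSkeletonFrmFrom ↦ PlanarSkeletonFrmQuasi`)
# of the tree module «Transplant/SkelFrmFromBParamsFaceBandAR0» (sha256 8507809788e2cb89…) onto the quasi-step carrier `PlanarSkeletonFrmQuasi` (p507026): «SkelFrmQuasiBParamsFaceBandAR0»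

HAND HUNK (L-FLOORMAP-1 ①⑥ / L-KitS-1 reader side; G017 «SkelFrmQuasiBChoiceNums», hp-8's KitSN): KS0.R'0→KS0.R'0N×15 — the kit of record at window cost `KS.NQ Φ`.

ORIGINAL TITLE: N2 (frames-only node `SamePDropOfSkeletonFrmFrom₁`, OPEN) params column over `PlanarSkeletonFrm` — (F) value layer, **J19 / R0 SUCCESSOR of

builds on p205010 (kernel theorem, internal audit signed; external expert review pending) — nothing in this file uses p205010; NOTHING is claimed about any open node
((N3-b), the end state).  Lane `prim-bschramm`, seat `prim-bschramm-stmt` (gen 33; GEN-Q column pen; tool = captain gen-1 g4's port_genq.py R-14 --cone + p3-g30's T1 patch).  Helper file (`--supports stmt-CriticalPhenomena-4575 --as helper`).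
PORT RULES (U-wave r1–r4 re-used, GEN-Q hunk classes of p3-g29 #6136): declaration order, names and proof texts are those of «SkelFrmFromBParamsFaceBandAR0», byte-identical except
(i) the carrier token `PlanarSkeletonFrmFrom ↦ PlanarSkeletonFrmQuasi` in binders, `namespace`/`end` lines and qualified names (module names `SkelFrmFrom… ↦ SkelFrmQuasi…`
in imports of already-ported rows); (ii) `Φ.step ↦ Φ.qstep` with the called Steps lemma replaced by its `…Q`/`_q` twin and the cost `Φ.M` threaded (none in this file unless
listed below); (iii) `Φ.cyl_connected ↦ Φ.cyl_reach` readers (none unless listed); (iv) graph-ball radii / window floors ×`Φ.M` (none unless listed).  Carrier-free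
residents stay imported/exported from the original «SkelFrmBParamsFaceBandAR0» exactly as in the FrmFrom port.  Docstrings and citations are the original's.

-/

noncomputable section

open scoped Classical

namespace Summit.CriticalPhenomena.PercolationContinuityZ3.Theorems.Transplant

namespace PlanarSkeletonFrmQuasi

namespace NegB

open Literature.Probability.Percolation Literature.Probability.LatticeModels SimpleGraph
open Literature.Probability.Percolation.KozmaNitzan.Cells (oth)
open SkelConc (Consts)
open Skelφ.StepI (DataN)
open Neg

/-! ## §0 The R′0 floors: box floor ⇒ cell floors ⇒ per-axis stride floor -/

section FloorsR0

/-- **stmt's Kq-currency dominates the box floor**: `22000·Kq·(R'0+2) ≤ M_L` gives `4·K·(R'0+2) ≤ M_L` (`K = 40·Kq`) and `22000·(R'0+2) ≤ M_L`. [folklore] -/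
theorem ML_floorR0_of_Kq (κ : Consts) {V : Type} [DecidableEq V] [Countable V] {G : SimpleGraph V} [G.LocallyFinite] (Φ : PlanarSkeletonFrmQuasi G) (t : V) (p : unitInterval) (D : Skelφ.StepI.DataNS V) (g : ℕ) (mk : ℕ)
    (hKq : 22000 * Neg.Kq κ * (KS0.R'0N κ Φ (KS.NQ Φ) t p D mk + 2) ≤ ML κ Φ t p D g) :
    4 * Neg.K κ * (KS0.R'0N κ Φ (KS.NQ Φ) t p D mk + 2) ≤ ML κ Φ t p D g ∧ 22000 * (KS0.R'0N κ Φ (KS.NQ Φ) t p D mk + 2) ≤ ML κ Φ t p D g := by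
  have hK : Neg.K κ = 40 * Neg.Kq κ := Neg.K_eq κ
  have h1 : 1 ≤ Neg.Kq κ := Neg.one_le_Kq κ
  constructor
  · calc 4 * Neg.K κ * (KS0.R'0N κ Φ (KS.NQ Φ) t p D mk + 2) = 160 * Neg.Kq κ * (KS0.R'0N κ Φ (KS.NQ Φ) t p D mk + 2) := by rw [hK]; ring
      _ ≤ 22000 * Neg.Kq κ * (KS0.R'0N κ Φ (KS.NQ Φ) t p D mk + 2) := by gcongr; norm_num
      _ ≤ ML κ Φ t p D g := hKq
  · calc 22000 * (KS0.R'0N κ Φ (KS.NQ Φ) t p D mk + 2) = 22000 * 1 * (KS0.R'0N κ Φ (KS.NQ Φ) t p D mk + 2) := by ring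
      _ ≤ 22000 * Neg.Kq κ * (KS0.R'0N κ Φ (KS.NQ Φ) t p D mk + 2) := by gcongr
      _ ≤ ML κ Φ t p D g := hKq

/-- **THE (ζ′) CELLS DOMINATE THE (S0) KIT RADIUS** under the box floor `4·K·(R'0+2) ≤ M_L` (any `g`, `f`): `6·R'0 + 11 ≤ s₀` and `14·R'0 + 27 ≤ s₁`
(`KS.sA_ge_of_floor'`). [folklore] -/
theorem cells_geR0A (κ : Consts) {V : Type} [DecidableEq V] [Countable V] {G : SimpleGraph V} [G.LocallyFinite] (Φ : PlanarSkeletonFrmQuasi G) (t : V) (p : unitInterval) (D : Skelφ.StepI.DataNS V) (g : ℕ) (f : ℕ) (mk : ℕ) (hN : EqNumL κ Φ t p D g f) (hκ : (hL κ Φ t p D g f).natAbs ≤ 10 * nL κ Φ t p D g f)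
    (hMR0 : 4 * Neg.K κ * (KS0.R'0N κ Φ (KS.NQ Φ) t p D mk + 2) ≤ ML κ Φ t p D g) :
    6 * (KS0.R'0N κ Φ (KS.NQ Φ) t p D mk : ℤ) + 11 ≤ (((fcellsA κ Φ t p D g f).s 0 : ℕ) : ℤ) ∧ 14 * (KS0.R'0N κ Φ (KS.NQ Φ) t p D mk : ℤ) + 27 ≤ (((fcellsA κ Φ t p D g f).s 1 : ℕ) : ℤ) :=
  KS.sA_ge_of_floor' κ Φ t p D g f hN hκ hMR0

/-- **The (ζ′) stride unit of the transverse axis `J := oth I` vs the (S0) kit radius** at `g := gT`: `r_J = 40·Kq·u_JA`, `6·R'0 + 11 ≤ u_JA` (from the box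
floor `4·K·(R'0+2) ≤ M_L (gT mk gx)`), `40·u_JA ≤ r_J` — the R′0 successor of `uA_oth_facts`. [folklore] -/
theorem uA_oth_factsR0 (κ : Consts) {V : Type} [DecidableEq V] [Countable V] {G : SimpleGraph V} [G.LocallyFinite] (Φ : PlanarSkeletonFrmQuasi G) (t : V) (p : unitInterval) (D : Skelφ.StepI.DataNS V) (f : ℕ) (mk : ℕ) (gx : Neg.FSlot) (hN : EqNumL κ Φ t p D (KS.gT mk gx κ Φ t p D) f) (hκ : (hL κ Φ t p D (KS.gT mk gx κ Φ t p D) f).natAbs ≤ 10 * nL κ Φ t p D (KS.gT mk gx κ Φ t p D) f)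
    (hMR0 : 4 * Neg.K κ * (KS0.R'0N κ Φ (KS.NQ Φ) t p D mk + 2) ≤ ML κ Φ t p D (KS.gT mk gx κ Φ t p D)) (I : Fin 2) :
    ((fcellsA κ Φ t p D (KS.gT mk gx κ Φ t p D) f).r (oth I) : ℤ) =
        40 * (Neg.Kq κ : ℤ) * (if oth I = 0 then KS.u₀A κ Φ t p D (KS.gT mk gx κ Φ t p D) f else KS.u₁A κ Φ t p D (KS.gT mk gx κ Φ t p D) f) ∧
      6 * (KS0.R'0N κ Φ (KS.NQ Φ) t p D mk : ℤ) + 11 ≤ (if oth I = 0 then KS.u₀A κ Φ t p D (KS.gT mk gx κ Φ t p D) f else KS.u₁A κ Φ t p D (KS.gT mk gx κ Φ t p D) f) ∧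
      40 * (if oth I = 0 then KS.u₀A κ Φ t p D (KS.gT mk gx κ Φ t p D) f else KS.u₁A κ Φ t p D (KS.gT mk gx κ Φ t p D) f) ≤
        ((fcellsA κ Φ t p D (KS.gT mk gx κ Φ t p D) f).r (oth I) : ℤ) := by
  obtain ⟨hr, -, hru⟩ := uA_oth_facts κ Φ t p D f mk gx hN hκ I
  obtain ⟨g0, g1⟩ := cells_geR0A κ Φ t p D (KS.gT mk gx κ Φ t p D) f mk hN hκ hMR0
  have hR : (0 : ℤ) ≤ (KS0.R'0N κ Φ (KS.NQ Φ) t p D mk : ℤ) := Nat.cast_nonneg _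
  refine ⟨hr, ?_, hru⟩
  obtain rfl | rfl : I = 0 ∨ I = 1 := by fin_cases I <;> simp
  · rw [show oth (0 : Fin 2) = 1 from rfl]
    simp only [show ((1 : Fin 2) = 0) = False from propext ⟨fun h => absurd h (by decide), False.elim⟩, if_false]
    unfold KS.u₁A; linarith
  · rw [show oth (1 : Fin 2) = 0 from rfl]
    simp only [if_true]
    unfold KS.u₀A; linarith

end FloorsR0

/-! ## §1 The contact band's habitat floors at `Rl ≤ R′0` -/

section Band

-- GEN-Q (R-2, captain 2026-08-27): `PlanarSkeletonFrmFrom.NegB.hkE_R0` is not in the used cone of the node top — not ported.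

end Band

end NegB

end PlanarSkeletonFrmQuasi

end Summit.CriticalPhenomena.PercolationContinuityZ3.Theorems.Transplant

end
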